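import Mathlib.Data.Nat.Bitwise
import Mathlib.Data.Finset.Card
import Mathlib.Data.Finset.Filter

/-!
# A kernel-checkable bound on independent sets (branch and bound with a clique-cover bound)

ω-census infrastructure (pub-omega lit g17, for the α-instances of the box bound `ProductBoxBound.box_bound`,
census row NR138).  Framing: lottery ticket; floor = certified bounds/negative ranges.

Vertices are natural numbers, vertex sets are bitmasks (`ℕ`, `Nat.testBit`).  `srch vs cand size need cover`
explores, in the fixed order of the vertex list `vs = [(v, m_v), …]` (`m_v` a bitmask of SOME neighbours of
`v`), all independent sets inside the candidate mask `cand`, pruning with the bound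
"`size + #{c ∈ cover : c ∩ cand ≠ ∅} < need`" for a list `cover` of clique bitmasks covering every listed
vertex.  **`srch_sound`**: if the data are valid for an adjacency relation `adj` (every `m_v` bit is a true
neighbour, every `c ∈ cover` is a clique, every listed vertex lies in some `c` — three hypotheses, stated inline;
no `Prop`-valued definition is introduced) and `srch … = true`, then every `adj`-independent finite set `I` of
listed vertices inside `cand` has `size + |I| < need`; `srch_sound_top` is the `size = 0` form (`|I| ≤ need − 1`).
The three validity hypotheses have a Boolean, `decide`-able certificate `chk` (`mask_of_chk`, `clique_of_chk`,
`covers_of_chk`) for masks below `2 ^ N` and a Boolean adjacency test.  All functions use only kernel-accelerated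
`Nat` operations (`&&&`, `|||`, `^^^`, `^`, `testBit`), so instances are proved by `decide +kernel`.
Elementary; no literature claim (a textbook branch-and-bound with the clique-cover bound of maximum-independent-
set solvers); it lives under `Summits/` as cell infrastructure, like `stppCheck`.

Sizing for the intended use (pub-omega lit g17, kit j190574 + scratch): the 100 normalised `S₃` boxes of
`α_{S₃}(6,3,3) ≤ 10` (54 cells each, 12-clique covers from an ILP) take 2 919 203 `srch` nodes in total
(median box 31 299, worst 76 617); one box of 54 733 nodes elaborates by `decide +kernel` in ≈ 30 s wall.
Usage: instantiate `adjb` (e.g. `fun u w => (table.getD u 0).testBit w`), prove `chk … = true` and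
`srch vs cand 0 need cover = true` by `decide +kernel`, conclude with `card_lt_of_chk_of_srch`, and transport
to the geometric statement (cells of `Q × Q × Q`, `ProductBoxBound.cellWord`) by a decidable dictionary.
-/

namespace Summit.MatrixMultiplication.OmegaCensus.IndepSetBound

/-- number of cover masks meeting `cand` -/
def cnt : List ℕ → ℕ → ℕ
  | [], _ => 0
  | c :: cs, cand => (if c &&& cand = 0 then 0 else 1) + cnt cs cand

/-- Branch and bound.  `true` certifies: no `adj`-independent set `I` of listed vertices inside `cand` has
`size + |I| ≥ need` (see `srch_sound`). -/
def srch : List (ℕ × ℕ) → ℕ → ℕ → ℕ → List ℕ → Bool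
  | [], _, size, need, _ => decide (size < need)
  | (v, m) :: vs, cand, size, need, cover =>
    if need ≤ size then false
    else if size + cnt cover cand < need then true
    else if cand.testBit v then
      srch vs (cand ^^^ (cand &&& (m ||| 2 ^ v))) (size + 1) need cover &&
        srch vs (cand ^^^ 2 ^ v) size need cover
    else srch vs cand size need cover

variable {adj : ℕ → ℕ → Prop}

/-- The clique-cover bound: an independent set inside `cand` whose members are all covered by cliques of
`cover` has at most `cnt cover cand` members. -/
theorem card_le_cnt (cover : List ℕ)
    (hcl : ∀ c ∈ cover, ∀ u w, c.testBit u = true → c.testBit w = true → u ≠ w → adj u w ∨ adj w u)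
    (cand : ℕ) (I : Finset ℕ) (hI : ∀ u ∈ I, ∀ w ∈ I, u ≠ w → ¬ adj u w) (hcand : ∀ u ∈ I, cand.testBit u = true)
    (hcov : ∀ u ∈ I, ∃ c ∈ cover, c.testBit u = true) : I.card ≤ cnt cover cand := by
  classical
  induction cover generalizing I with
  | nil =>
    have : I = ∅ := Finset.eq_empty_of_forall_notMem fun u hu => by
      obtain ⟨c, hc, _⟩ := hcov u hu; simp at hc
    simp [this, cnt]
  | cons c cs ih =>
    set I₁ := I.filter (fun u => c.testBit u = true) with hI₁
    set I₂ := I.filter (fun u => ¬ c.testBit u = true) with hI₂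
    have hsplit : I₁.card + I₂.card = I.card := Finset.card_filter_add_card_filter_not _
    -- at most one member of `I` lies in the clique `c`
    have h1 : I₁.card ≤ 1 := by
      rw [Finset.card_le_one]
      intro u hu w hw
      rw [hI₁, Finset.mem_filter] at hu hw
      by_contra hne
      rcases hcl c (by simp) u w hu.2 hw.2 hne with h | h
      · exact hI u hu.1 w hw.1 hne h
      · exact hI w hw.1 u hu.1 (Ne.symm hne) h
    -- and if there is one, `c` meets `cand`
    have h1' : I₁.card ≤ (if c &&& cand = 0 then 0 else 1) := by
      split_ifs with h0
      · rw [Nat.le_zero, Finset.card_eq_zero, Finset.eq_empty_iff_forall_notMem]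
        intro u hu
        rw [hI₁, Finset.mem_filter] at hu
        have hb : (c &&& cand).testBit u = true := by rw [Nat.testBit_land, hu.2, hcand u hu.1]; rfl
        rw [h0, Nat.zero_testBit] at hb
        exact Bool.false_ne_true hb
      · exact h1
    -- the rest is covered by `cs`
    have h2 : I₂.card ≤ cnt cs cand := by
      refine ih (fun c' hc' => hcl c' (by simp [hc'])) I₂
        (fun u hu w hw => hI u (Finset.mem_of_mem_filter u hu) w (Finset.mem_of_mem_filter w hw))
        (fun u hu => hcand u (Finset.mem_of_mem_filter u hu)) fun u hu => ?_
      rw [hI₂, Finset.mem_filter] at hu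
      obtain ⟨c', hc', hb⟩ := hcov u hu.1
      rcases List.mem_cons.mp hc' with rfl | hc'
      · exact absurd hb hu.2
      · exact ⟨c', hc', hb⟩
    show I.card ≤ (if c &&& cand = 0 then 0 else 1) + cnt cs cand
    omega

/-- **Soundness of the search.** -/
theorem srch_sound {vs : List (ℕ × ℕ)} {cover : List ℕ}
    (hmask : ∀ p ∈ vs, ∀ u, p.2.testBit u = true → u ≠ p.1 → adj p.1 u ∨ adj u p.1)
    (hclique : ∀ c ∈ cover, ∀ u w, c.testBit u = true → c.testBit w = true → u ≠ w → adj u w ∨ adj w u)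
    (hcovers : ∀ p ∈ vs, ∃ c ∈ cover, c.testBit p.1 = true) {cand size need : ℕ}
    (h : srch vs cand size need cover = true) (I : Finset ℕ)
    (hvs : ∀ u ∈ I, ∃ p ∈ vs, p.1 = u) (hcand : ∀ u ∈ I, cand.testBit u = true)
    (hI : ∀ u ∈ I, ∀ w ∈ I, u ≠ w → ¬ adj u w) : size + I.card < need := by
  classical
  induction vs generalizing cand size I with
  | nil =>
    have : I = ∅ := Finset.eq_empty_of_forall_notMem fun u hu => by
      obtain ⟨p, hp, _⟩ := hvs u hu; simp at hp
    subst this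
    simpa [srch] using h
  | cons p vs ih =>
    obtain ⟨v, m⟩ := p
    have hmask' : ∀ q ∈ vs, ∀ u, q.2.testBit u = true → u ≠ q.1 → adj q.1 u ∨ adj u q.1 :=
      fun q hq => hmask q (List.mem_cons_of_mem _ hq)
    have hcovers' : ∀ q ∈ vs, ∃ c ∈ cover, c.testBit q.1 = true :=
      fun q hq => hcovers q (List.mem_cons_of_mem _ hq)
    simp only [srch] at h
    split_ifs at h with hle hbound hbit
    · -- bound prunes: `size + cnt < need` and `|I| ≤ cnt`
      have := card_le_cnt cover hclique cand I hI hcand fun u hu => by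
        obtain ⟨q, hq, rfl⟩ := hvs u hu; exact hcovers q hq
      omega
    · -- branch on `v ∈ I`
      rw [Bool.and_eq_true] at h
      by_cases hvI : v ∈ I
      · -- include `v`: the rest of `I` survives the removal of `v` and of the mask bits
        have hsub : I.erase v ⊆ I := Finset.erase_subset v I
        have key := ih hmask' hcovers' h.1 (I.erase v) (fun u hu => ?_) (fun u hu => ?_)
          (fun u hu w hw => hI u (hsub hu) w (hsub hw))
        · rw [Finset.card_erase_of_mem hvI] at key
          have := Finset.card_pos.mpr ⟨v, hvI⟩
          omega
        · obtain ⟨huv, huI⟩ := Finset.mem_erase.mp hu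
          obtain ⟨q, hq, hqu⟩ := hvs u huI
          rcases List.mem_cons.mp hq with rfl | hq
          · exact absurd hqu.symm huv
          · exact ⟨q, hq, hqu⟩
        · obtain ⟨huv, huI⟩ := Finset.mem_erase.mp hu
          have hm : m.testBit u = false := by
            by_contra hmu
            rw [Bool.not_eq_false] at hmu
            rcases hmask (v, m) (by simp) u hmu huv with ha | ha
            · exact hI v hvI u huI (Ne.symm huv) ha
            · exact hI u huI v hvI huv ha
          have hpow : (2 ^ v).testBit u = false := by
            rw [Nat.testBit_two_pow]; exact decide_eq_false (Ne.symm huv)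
          rw [Nat.testBit_xor, Nat.testBit_land, Nat.testBit_lor, hm, hpow, hcand u huI]
          rfl
      · -- exclude `v`
        refine ih hmask' hcovers' h.2 I (fun u hu => ?_) (fun u hu => ?_) hI
        · obtain ⟨q, hq, hqu⟩ := hvs u hu
          rcases List.mem_cons.mp hq with rfl | hq
          · simp only at hqu; subst hqu; exact absurd hu hvI
          · exact ⟨q, hq, hqu⟩
        · have huv : v ≠ u := fun h => hvI (h ▸ hu)
          have hpow : (2 ^ v).testBit u = false := by
            rw [Nat.testBit_two_pow]; exact decide_eq_false huv
          rw [Nat.testBit_xor, hpow, hcand u hu]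
          rfl
    · -- `v ∉ cand`, hence `v ∉ I`
      refine ih hmask' hcovers' h I (fun u hu => ?_) hcand hI
      obtain ⟨q, hq, hqu⟩ := hvs u hu
      rcases List.mem_cons.mp hq with rfl | hq
      · exact absurd (hcand u hu) (by rw [← hqu]; simpa using hbit)
      · exact ⟨q, hq, hqu⟩

/-- The `size = 0` form: with the full candidate mask, every independent set of listed vertices has fewer
than `need` members. -/
theorem srch_sound_top {vs : List (ℕ × ℕ)} {cover : List ℕ}
    (hmask : ∀ p ∈ vs, ∀ u, p.2.testBit u = true → u ≠ p.1 → adj p.1 u ∨ adj u p.1)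
    (hclique : ∀ c ∈ cover, ∀ u w, c.testBit u = true → c.testBit w = true → u ≠ w → adj u w ∨ adj w u)
    (hcovers : ∀ p ∈ vs, ∃ c ∈ cover, c.testBit p.1 = true) {cand need : ℕ}
    (h : srch vs cand 0 need cover = true) (I : Finset ℕ) (hvs : ∀ u ∈ I, ∃ p ∈ vs, p.1 = u)
    (hcand : ∀ u ∈ I, cand.testBit u = true) (hI : ∀ u ∈ I, ∀ w ∈ I, u ≠ w → ¬ adj u w) : I.card < need := by
  simpa using srch_sound hmask hclique hcovers h I hvs hcand hI

/-! ### A decidable certificate for the three validity hypotheses (masks below `2 ^ N`, Boolean `adj`) -/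

/-- all bits of `x` at positions `< N` satisfying `P`, as a Boolean check -/
def allBits (N : ℕ) (x : ℕ) (P : ℕ → Bool) : Bool :=
  (List.range N).all fun u => !x.testBit u || P u

/-- `allBits N x P` certifies `P u` for every bit `u` of `x`, when `x < 2 ^ N`. -/
theorem allBits_spec {N x : ℕ} {P : ℕ → Bool} (hx : x < 2 ^ N) (h : allBits N x P = true) (u : ℕ)
    (hu : x.testBit u = true) : P u = true := by
  have huN : u < N := by
    by_contra hN
    rw [Nat.testBit_lt_two_pow (lt_of_lt_of_le hx (Nat.pow_le_pow_right (by omega) (not_lt.mp hN)))]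
      at hu
    exact Bool.false_ne_true hu
  have := List.all_eq_true.mp h u (List.mem_range.mpr huN)
  simpa [hu] using this

/-- Boolean certificate for the three validity hypotheses w.r.t. a Boolean adjacency test `adjb`. -/
def chk (adjb : ℕ → ℕ → Bool) (N : ℕ) (vs : List (ℕ × ℕ)) (cover : List ℕ) : Bool :=
  (vs.all fun p => decide (p.2 < 2 ^ N) &&
      allBits N p.2 fun u => decide (u = p.1) || adjb p.1 u || adjb u p.1) &&
  (cover.all fun c => decide (c < 2 ^ N) &&
      allBits N c fun u => allBits N c fun w => decide (u = w) || adjb u w || adjb w u) &&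
  (vs.all fun p => cover.any fun c => c.testBit p.1)

variable {adjb : ℕ → ℕ → Bool} {N : ℕ} {vs : List (ℕ × ℕ)} {cover : List ℕ}

/-- `chk` certifies the mask hypothesis of `srch_sound`. -/
theorem mask_of_chk (h : chk adjb N vs cover = true) :
    ∀ p ∈ vs, ∀ u, p.2.testBit u = true → u ≠ p.1 → adjb p.1 u = true ∨ adjb u p.1 = true := by
  simp only [chk, Bool.and_eq_true, List.all_eq_true, decide_eq_true_eq] at h
  intro p hp u hu hne
  obtain ⟨hlt, hall⟩ := h.1.1 p hp
  have := allBits_spec hlt hall u hu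
  simp only [Bool.or_eq_true, decide_eq_true_eq] at this
  tauto

/-- `chk` certifies the clique hypothesis of `srch_sound`. -/
theorem clique_of_chk (h : chk adjb N vs cover = true) :
    ∀ c ∈ cover, ∀ u w, c.testBit u = true → c.testBit w = true → u ≠ w →
      adjb u w = true ∨ adjb w u = true := by
  simp only [chk, Bool.and_eq_true, List.all_eq_true, decide_eq_true_eq] at h
  intro c hcm u w hu hw hne
  obtain ⟨hlt, hall⟩ := h.1.2 c hcm
  have h1 := allBits_spec hlt hall u hu
  have h2 := allBits_spec hlt h1 w hw
  simp only [Bool.or_eq_true, decide_eq_true_eq] at h2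
  tauto

/-- `chk` certifies the covering hypothesis of `srch_sound`. -/
theorem covers_of_chk (h : chk adjb N vs cover = true) :
    ∀ p ∈ vs, ∃ c ∈ cover, c.testBit p.1 = true := by
  simp only [chk, Bool.and_eq_true, List.all_eq_true, decide_eq_true_eq] at h
  intro p hp
  obtain ⟨c, hc1, hc2⟩ := List.any_eq_true.mp (h.2 p hp)
  exact ⟨c, hc1, hc2⟩

/-- **Certified bound, packaged**: from the two kernel computations `chk … = true` and `srch vs cand 0 need cover
= true`, every set of listed vertices inside `cand` that is independent for `adjb` has fewer than `need`
elements. -/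
theorem card_lt_of_chk_of_srch (hchk : chk adjb N vs cover = true) {cand need : ℕ}
    (h : srch vs cand 0 need cover = true) (I : Finset ℕ) (hvs : ∀ u ∈ I, ∃ p ∈ vs, p.1 = u)
    (hcand : ∀ u ∈ I, cand.testBit u = true)
    (hI : ∀ u ∈ I, ∀ w ∈ I, u ≠ w → adjb u w = false) : I.card < need :=
  srch_sound_top (adj := fun u w => adjb u w = true) (mask_of_chk hchk) (clique_of_chk hchk)
    (covers_of_chk hchk) h I hvs hcand fun u hu w hw hne => by simpa using hI u hu w hw hne

end Summit.MatrixMultiplication.OmegaCensus.IndepSetBound
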